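import Literature.NumberTheory.Sieve.CFSemigroupLipRPF
import Literature.NumberTheory.Sieve.CFSemigroupAperiodic
import HarnessLib

/-!
# Invertibility of `1 - L_s` on the boundary line `Re s = δ_A`, `s ≠ δ_A`

Support file (all results proved) for the named fact
`Literature.NumberTheory.Sieve.MageeOhWinter2019_uniformCounting` (`CFSemigroupCounting.lean`).
The renewal theorem for `Γ_A` (Lalley; [MageeOhWinter2019, Prop. 17, Lemma 15]) needs, besides the
simple pole of the resolvent `(1 - L_s)^{-1}` at `s = δ`, its holomorphy at every other point of
the line `Re s = δ`: "`N` is non-lattice and so `1 - L_{-sτ}` is invertible for nonzero real `a`"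
([MageeOhWinter2019, proof of Lemma 15]; [Lalley, Thm. 7.1]; [Naud, Prop. 6.4]). We prove this for
the operators `L_s` on the Lipschitz space `CfLip`, `s = δ + it`, `t ≠ 0`:

* `exists_unimodular_eigenvector`: if `Tᴺ x = x` with `x ≠ 0` then `T` has an eigenvector whose
  eigenvalue is an `N`-th root of unity (discrete Fourier averaging);
* `isUnit_one_sub_of_finiteDimensional_range`: the Fredholm alternative in the finite-rank case:
  on a Banach space, `1 - K` is a unit as soon as it is injective, for `K` of finite rank;
* `cfKOp`, `cfSOp`: the decomposition `L_sᴺ = K_N + S_N` with `K_N` of finite rank (the word sum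
  with the argument of `F` frozen at the base point `0`) and
  `‖S_N‖ ≤ 4^σ λ_σᴺ 2^{1-N} (2 + 2‖s‖e^{2‖s‖})` (uniform contraction of the branches and bounded
  distortion, as in the Lasota–Yorke inequality);
* `isUnit_one_sub_cfLOp_boundary`: for `t ≠ 0`, `1 - L_{δ+it}` is a unit of `End(CfLip)`: by the
  non-lattice property (`cfLC_eigenfunction_eq_zero`, `CFSemigroupAperiodic.lean`) `L_{δ+it}` has no
  unimodular eigenvalue on `CfLip`, hence `1 - L_{δ+it}ᴺ = (1 - S_N)(1 - (1 - S_N)^{-1} K_N)` is a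
  unit for `N` large, hence so is `1 - L_{δ+it}`. [cite: MageeOhWinter2019, Lemma 15]

## References

* M. Magee, H. Oh, D. Winter, J. reine angew. Math. 753 (2019) 89–135, Lemma 15, Prop. 17.
  [MageeOhWinter2019]
* S. P. Lalley, Acta Math. 163 (1989) 1–55, Thm. 7.1.
* F. Naud, Ann. Sci. ENS 38 (2005) 116–153, Prop. 6.4.
-/

noncomputable section

open Set Filter Finset
open scoped Topology

namespace Literature.NumberTheory.Sieve

variable {A : Finset ℕ}

/-! ### Unimodular eigenvectors from fixed vectors of a power -/

section Eigen

variable {V : Type*} [NormedAddCommGroup V] [NormedSpace ℂ V]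

/-- **Discrete Fourier averaging:** if `T^{n+1} x = x` and `ω^{n+1} = 1` then
`v = Σ_{i ≤ n} ω^{-i} Tⁱ x` satisfies `T v = ω v`. [folklore] -/
theorem apply_fourierAverage_eq (T : V →L[ℂ] V) {n : ℕ} {x : V} (hfix : (T ^ (n + 1)) x = x)
    {ω : ℂ} (hω : ω ^ (n + 1) = 1) :
    T (∑ i ∈ range (n + 1), (ω⁻¹) ^ i • (T ^ i) x) =
      ω • ∑ i ∈ range (n + 1), (ω⁻¹) ^ i • (T ^ i) x := by
  have hω0 : ω ≠ 0 := fun h => by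
    rw [h, zero_pow (Nat.succ_ne_zero n)] at hω
    exact zero_ne_one hω
  have hωc : ω * ω⁻¹ = 1 := mul_inv_cancel₀ hω0
  have hcn : (ω⁻¹) ^ n = ω := by
    rw [inv_pow]
    have h1 : ω ^ n * ω = 1 := by rw [← pow_succ, hω]
    rw [eq_inv_of_mul_eq_one_left h1, inv_inv]
  have hT : ∀ i, T ((T ^ i) x) = (T ^ (i + 1)) x := fun i => by
    rw [pow_succ', ContinuousLinearMap.mul_def, ContinuousLinearMap.coe_comp, Function.comp_apply]
  rw [map_sum, Finset.smul_sum]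
  simp_rw [map_smul, hT]
  rw [Finset.sum_range_succ, Finset.sum_range_succ', hfix, hcn, pow_zero, pow_zero, one_smul,
    ContinuousLinearMap.one_def, ContinuousLinearMap.coe_id', id_eq]
  congr 1
  refine Finset.sum_congr rfl fun i _ => ?_
  rw [smul_smul, pow_succ' ω⁻¹ i, ← mul_assoc, hωc, one_mul]

/-- **A fixed vector of `Tᴺ` produces a unimodular eigenvalue of `T`:** if `Tᴺ x = x`, `x ≠ 0`,
`N ≥ 1`, then `T v = ω v` for some `v ≠ 0` and some `N`-th root of unity `ω`. [folklore] -/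
theorem exists_unimodular_eigenvector (T : V →L[ℂ] V) {N : ℕ} (hN : 0 < N) {x : V} (hx : x ≠ 0)
    (hfix : (T ^ N) x = x) : ∃ (ω : ℂ) (v : V), ‖ω‖ = 1 ∧ v ≠ 0 ∧ T v = ω • v := by
  obtain ⟨n, rfl⟩ : ∃ n, N = n + 1 := ⟨N - 1, by omega⟩
  set ζ : ℂ := Complex.exp (2 * Real.pi * Complex.I / ((n + 1 : ℕ) : ℂ)) with hζdef
  have hζ : IsPrimitiveRoot ζ (n + 1) := Complex.isPrimitiveRoot_exp (n + 1) (Nat.succ_ne_zero n)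
  have hζi : IsPrimitiveRoot ζ⁻¹ (n + 1) := hζ.inv
  set v : ℕ → V := fun k => ∑ i ∈ range (n + 1), ((ζ ^ k)⁻¹) ^ i • (T ^ i) x with hvdef
  have hωk : ∀ k, (ζ ^ k) ^ (n + 1) = 1 := fun k => by
    rw [← pow_mul, mul_comm, pow_mul, hζ.pow_eq_one, one_pow]
  have hv : ∀ k, T (v k) = (ζ ^ k) • v k := fun k => apply_fourierAverage_eq T hfix (hωk k)
  -- `Σ_k v k = (n+1) x`
  have hcoef : ∀ i ∈ range (n + 1),
      ∑ k ∈ range (n + 1), ((ζ ^ k)⁻¹) ^ i = if i = 0 then ((n + 1 : ℕ) : ℂ) else 0 := by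
    intro i hi
    have e : ∀ k, ((ζ ^ k)⁻¹) ^ i = ((ζ⁻¹) ^ i) ^ k := fun k => by
      rw [inv_pow, inv_pow, inv_pow, ← pow_mul, ← pow_mul, mul_comm]
    simp_rw [e]
    split_ifs with h0
    · simp [h0]
    · have hρ1 : (ζ⁻¹) ^ i ≠ 1 := hζi.pow_ne_one_of_pos_of_lt h0 (Finset.mem_range.1 hi)
      rw [geom_sum_eq hρ1, ← pow_mul, mul_comm, pow_mul, hζi.pow_eq_one, one_pow, sub_self, zero_div]
  have hsum : ∑ k ∈ range (n + 1), v k = ((n + 1 : ℕ) : ℂ) • x := by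
    simp only [hvdef]
    rw [Finset.sum_comm]
    rw [Finset.sum_congr rfl fun i hi => by rw [← Finset.sum_smul, hcoef i hi]]
    rw [Finset.sum_eq_single 0 (fun i _ hi => by rw [if_neg hi, zero_smul])
      (fun h => absurd (Finset.mem_range.2 (Nat.succ_pos n)) h)]
    rw [if_pos rfl, pow_zero, ContinuousLinearMap.one_def, ContinuousLinearMap.coe_id', id_eq]
  have hne : ∑ k ∈ range (n + 1), v k ≠ 0 := by
    rw [hsum]
    exact smul_ne_zero (Nat.cast_ne_zero.2 (Nat.succ_ne_zero n)) hx
  obtain ⟨k, -, hk⟩ := Finset.exists_ne_zero_of_sum_ne_zero hne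
  exact ⟨ζ ^ k, v k, Complex.norm_eq_one_of_pow_eq_one (hωk k) (Nat.succ_ne_zero n), hk, hv k⟩

end Eigen

/-! ### The Fredholm alternative for finite-rank perturbations of the identity -/

section Fredholm

variable {V : Type*} [NormedAddCommGroup V] [NormedSpace ℂ V] [CompleteSpace V]

/-- **Fredholm alternative, finite-rank case:** on a Banach space, if `K` has finite-dimensional
range and `1 - K` is injective, then `1 - K` is a unit of `End(V)`. [folklore] -/
theorem isUnit_one_sub_of_finiteDimensional_range (K : V →L[ℂ] V)
    (hfin : FiniteDimensional ℂ (LinearMap.range (K : V →ₗ[ℂ] V)))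
    (hinj : ∀ x, K x = x → x = 0) : IsUnit (1 - K) := by
  set W := LinearMap.range (K : V →ₗ[ℂ] V) with hW
  haveI := hfin
  have hKmem : ∀ y : V, K y ∈ W := fun y => LinearMap.mem_range_self (K : V →ₗ[ℂ] V) y
  have hmem : ∀ w : W, (w : V) - K w ∈ W := fun w => W.sub_mem w.2 (hKmem _)
  let φ : W →ₗ[ℂ] W :=
    { toFun := fun w => ⟨(w : V) - K w, hmem w⟩
      map_add' := fun a b => by
        ext
        simp only [Submodule.coe_add, map_add]
        abel
      map_smul' := fun c a => by
        ext
        simp only [Submodule.coe_smul, map_smul, RingHom.id_apply, smul_sub] }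
  have hφ : ∀ w : W, ((φ w : W) : V) = (w : V) - K w := fun w => rfl
  have hφinj : Function.Injective φ := by
    intro a b hab
    have h : (a : V) - K a = (b : V) - K b := by rw [← hφ, ← hφ, hab]
    have h2 : K ((a : V) - b) = (a : V) - b := by
      rw [map_sub]
      have := sub_eq_sub_iff_sub_eq_sub.1 h
      -- a - K a = b - K b  ⇒  a - b = K a - K b
      exact this.symm
    exact Subtype.ext (sub_eq_zero.1 (hinj _ h2))
  have hφsurj : Function.Surjective φ := LinearMap.injective_iff_surjective.1 hφinj
  have hsurj : ∀ y : V, ∃ x : V, x - K x = y := by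
    intro y
    obtain ⟨w, hw⟩ := hφsurj ⟨K y, hKmem y⟩
    have h : (w : V) - K w = K y := by rw [← hφ, hw]
    refine ⟨y + w, ?_⟩
    rw [map_add]
    calc y + (w : V) - (K y + K w) = y + ((w : V) - K w - K y) := by abel
      _ = y := by rw [h, sub_self, add_zero]
  have hker : LinearMap.ker (((1 : V →L[ℂ] V) - K : V →L[ℂ] V) : V →ₗ[ℂ] V) = ⊥ :=
    LinearMap.ker_eq_bot'.2 fun x hx => by
      have hx' : x - K x = 0 := hx
      exact hinj x (sub_eq_zero.1 hx').symm
  have hrange : LinearMap.range (((1 : V →L[ℂ] V) - K : V →L[ℂ] V) : V →ₗ[ℂ] V) = ⊤ :=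
    LinearMap.range_eq_top.2 fun y => by
      obtain ⟨x, hx⟩ := hsurj y
      exact ⟨x, hx⟩
  set e := ContinuousLinearEquiv.ofBijective ((1 : V →L[ℂ] V) - K) hker hrange with he
  refine ⟨⟨(1 : V →L[ℂ] V) - K, (e.symm : V →L[ℂ] V), ?_, ?_⟩, rfl⟩
  · refine ContinuousLinearMap.ext fun y => ?_
    show ((1 : V →L[ℂ] V) - K) (e.symm y) = y
    have : ((1 : V →L[ℂ] V) - K) (e.symm y) = e (e.symm y) := rfl
    rw [this, e.apply_symm_apply]
  · refine ContinuousLinearMap.ext fun y => ?_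
    show e.symm (((1 : V →L[ℂ] V) - K) y) = y
    have : ((1 : V →L[ℂ] V) - K) y = e y := rfl
    rw [this, e.symm_apply_apply]

end Fredholm

/-! ### Finite sums in `CfLip` -/

/-- Pointwise evaluation of finite sums in `CfLip`. [folklore] -/
theorem CfLip.finset_sum_apply {ι : Type*} (S : Finset ι) (F : ι → CfLip) (x : Icc (0 : ℝ) 1) :
    (∑ i ∈ S, F i) x = ∑ i ∈ S, F i x := by
  have h := congrFun (map_sum CfLip.coeAddHom F S) x
  rw [Finset.sum_apply] at h
  exact h

/-! ### The frozen finite-rank part `K_N` of `L_sᴺ` and the remainder `S_N` -/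

section Frozen

variable (A) (hA : ∀ a ∈ A, 1 ≤ a)
include hA

/-- The weight `x ↦ wt_s(M_w, x)` of a word, as an element of `CfLip` (`Re s ≥ 0`): Lipschitz
constant `2‖s‖ e^{2‖s‖}` by bounded distortion. [folklore] -/
def cfWtLip {s : ℂ} (hs : 0 ≤ s.re) {N : ℕ} (w : Fin N → A) : CfLip :=
  CfLip.mk' (fun x => cfWt s (cfMat fun i => (w i : ℕ)) x) (2 * ‖s‖ * Real.exp (2 * ‖s‖)) fun x y => by
    have hw : ∀ i, 1 ≤ (fun i => (w i : ℕ)) i := one_le_coe_digit hA w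
    refine (norm_cfWt_sub_cfWt_le hw s x.2 y.2).trans ?_
    have hd1 : |(x : ℝ) - y| ≤ 1 := by
      rw [abs_le]; constructor <;> linarith [x.2.1, x.2.2, y.2.1, y.2.2]
    have hexp : Real.exp (2 * ‖s‖ * |(x : ℝ) - y|) ≤ Real.exp (2 * ‖s‖) :=
      Real.exp_le_exp.2 (by nlinarith [norm_nonneg s, abs_nonneg ((x : ℝ) - y)])
    have hq1 : (1 : ℝ) ≤ cfDenom (cfMat fun i => (w i : ℕ)) y :=
      (by exact_mod_cast one_le_cfQ hw : (1 : ℝ) ≤ (cfQ fun i => (w i : ℕ) : ℝ)).trans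
        (cfDenom_cfMat_mem hw y.2).1
    have hwt : ((cfDenom (cfMat fun i => (w i : ℕ)) y) ^ 2) ^ (-s.re) ≤ 1 :=
      Real.rpow_le_one_of_one_le_of_nonpos (by nlinarith) (by linarith)
    have h0 : 0 ≤ ((cfDenom (cfMat fun i => (w i : ℕ)) y) ^ 2) ^ (-s.re) := Real.rpow_nonneg (sq_nonneg _) _
    calc ((cfDenom (cfMat fun i => (w i : ℕ)) y) ^ 2) ^ (-s.re) *
          (2 * ‖s‖ * Real.exp (2 * ‖s‖ * |(x : ℝ) - y|) * |(x : ℝ) - y|)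
        ≤ 1 * (2 * ‖s‖ * Real.exp (2 * ‖s‖) * |(x : ℝ) - y|) := by
          refine mul_le_mul hwt ?_ (by positivity) zero_le_one
          exact mul_le_mul_of_nonneg_right (mul_le_mul_of_nonneg_left hexp (by positivity)) (abs_nonneg _)
      _ = _ := by ring

/-- Evaluation of `cfWtLip`. [folklore] -/
@[simp] theorem cfWtLip_apply {s : ℂ} (hs : 0 ≤ s.re) {N : ℕ} (w : Fin N → A) (x : Icc (0 : ℝ) 1) :
    cfWtLip A hA hs w x = cfWt s (cfMat fun i => (w i : ℕ)) x := rfl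

/-- The base points `M_w(0) ∈ [0,1]`. [folklore] -/
def cfBasePt {N : ℕ} (w : Fin N → A) : Icc (0 : ℝ) 1 :=
  ⟨cfMoeb (cfMat fun i => (w i : ℕ)) 0, cfMoeb_cfMat_mem (one_le_coe_digit hA w) (Set.left_mem_Icc.2 zero_le_one)⟩

/-- **The frozen operator** `K_N F = Σ_{w ∈ Aᴺ} F(M_w 0) · wt_s(M_w, ·)` (finite rank).
[folklore] -/
def cfKOp {s : ℂ} (hs : 0 ≤ s.re) (N : ℕ) : CfLip →L[ℂ] CfLip :=
  ∑ w : Fin N → A, (CfLip.eval (cfBasePt A hA w)).smulRight (cfWtLip A hA hs w)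

/-- Pointwise formula for `K_N`. [folklore] -/
theorem cfKOp_apply {s : ℂ} (hs : 0 ≤ s.re) (N : ℕ) (F : CfLip) (x : Icc (0 : ℝ) 1) :
    cfKOp A hA hs N F x =
      ∑ w : Fin N → A, cfWt s (cfMat fun i => (w i : ℕ)) x * F.extend (cfMoeb (cfMat fun i => (w i : ℕ)) 0) := by
  rw [cfKOp, _root_.sum_apply, CfLip.finset_sum_apply]
  refine Finset.sum_congr rfl fun w _ => ?_
  rw [ContinuousLinearMap.smulRight_apply, CfLip.smul_apply, CfLip.eval_apply, cfWtLip_apply, mul_comm]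
  congr 1
  exact (CfLip.extend_of_mem F (cfMoeb_cfMat_mem (one_le_coe_digit hA w) (Set.left_mem_Icc.2 zero_le_one))).symm

/-- `K_N` has finite rank: its range lies in the span of the finitely many word weights. [folklore] -/
theorem cfKOp_range_le {s : ℂ} (hs : 0 ≤ s.re) (N : ℕ) :
    LinearMap.range (cfKOp A hA hs N : CfLip →ₗ[ℂ] CfLip) ≤
      Submodule.span ℂ (Set.range fun w : Fin N → A => cfWtLip A hA hs w) := by
  rintro _ ⟨F, rfl⟩
  show cfKOp A hA hs N F ∈ _
  rw [cfKOp, _root_.sum_apply]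
  refine Submodule.sum_mem _ fun w _ => ?_
  rw [ContinuousLinearMap.smulRight_apply]
  exact Submodule.smul_mem _ _ (Submodule.subset_span ⟨w, rfl⟩)

/-- `range K_N` is finite-dimensional. [folklore] -/
theorem cfKOp_finiteDimensional {s : ℂ} (hs : 0 ≤ s.re) (N : ℕ) :
    FiniteDimensional ℂ (LinearMap.range (cfKOp A hA hs N : CfLip →ₗ[ℂ] CfLip)) := by
  haveI : FiniteDimensional ℂ (Submodule.span ℂ (Set.range fun w : Fin N → A => cfWtLip A hA hs w)) :=
    FiniteDimensional.span_of_finite ℂ (Set.finite_range _)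
  exact Submodule.finiteDimensional_of_le (cfKOp_range_le A hA hs N)

/-- **The remainder** `S_N = L_sᴺ - K_N`. [folklore] -/
def cfSOp {s : ℂ} (hs : 0 ≤ s.re) (N : ℕ) : CfLip →L[ℂ] CfLip := cfLOp A hA s ^ N - cfKOp A hA hs N

/-- Pointwise formula: `(S_N F)(x) = Σ_w wt_s(M_w, x) (F(M_w x) - F(M_w 0))`. [folklore] -/
theorem cfSOp_apply {s : ℂ} (hs : 0 ≤ s.re) (N : ℕ) (F : CfLip) (x : Icc (0 : ℝ) 1) :
    cfSOp A hA hs N F x = ∑ w : Fin N → A, cfWt s (cfMat fun i => (w i : ℕ)) x *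
      (F.extend (cfMoeb (cfMat fun i => (w i : ℕ)) x) - F.extend (cfMoeb (cfMat fun i => (w i : ℕ)) 0)) := by
  rw [cfSOp]
  show ((cfLOp A hA s ^ N) F - cfKOp A hA hs N F) x = _
  rw [CfLip.sub_apply, cfLOp_pow_apply, cfLC_iterate hA s _ N x.2, cfLCSum, cfKOp_apply, ← Finset.sum_sub_distrib]
  refine Finset.sum_congr rfl fun w _ => ?_
  ring

/-- The bound `(L_σᴺ 1)(x) ≤ 4^σ λ_σᴺ` in word-sum form. [folklore] -/
theorem cfTransferSum_one_le' (hne : A.Nonempty) {σ : ℝ} (hσ : 0 ≤ σ) (N : ℕ) {x : ℝ} (hx : x ∈ Icc (0 : ℝ) 1) :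
    cfTransferSum A σ N (fun _ => 1) x ≤ (4 : ℝ) ^ σ * cfEig A σ ^ N := by
  have h := (cfTransfer_iterate_one_div_mem hA hne hσ N hx).2
  rw [div_le_iff₀ (pow_pos (cfEig_pos _) N), cfTransfer_iterate hA σ _ N hx] at h
  exact h

/-- **Norm bound for the remainder:** `‖S_N‖ ≤ 4^σ λ_σᴺ 2^{1-N} (2 + 2‖s‖e^{2‖s‖})`, `σ = Re s ≥ 0`.
[folklore] -/
theorem norm_cfSOp_le (hne : A.Nonempty) {s : ℂ} (hs : 0 ≤ s.re) (N : ℕ) :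
    ‖cfSOp A hA hs N‖ ≤ (4 : ℝ) ^ s.re * cfEig A s.re ^ N * (1 / 2 : ℝ) ^ (N - 1) *
      (2 + 2 * ‖s‖ * Real.exp (2 * ‖s‖)) := by
  have hlam := cfEig_pos (A := A) s.re
  have hK0 : 0 ≤ (4 : ℝ) ^ s.re * cfEig A s.re ^ N := by positivity
  refine ContinuousLinearMap.opNorm_le_bound _ (by positivity) fun F => ?_
  -- per-word data
  have hw : ∀ w : Fin N → A, ∀ i, 1 ≤ (fun i => (w i : ℕ)) i := fun w => one_le_coe_digit hA w
  have hcontr : ∀ (w : Fin N → A) (x : Icc (0 : ℝ) 1),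
      ‖F.extend (cfMoeb (cfMat fun i => (w i : ℕ)) x) - F.extend (cfMoeb (cfMat fun i => (w i : ℕ)) 0)‖ ≤
        ‖F‖ * (1 / 2 : ℝ) ^ (N - 1) := by
    intro w x
    have hux := cfMoeb_cfMat_mem (hw w) x.2
    have hu0 := cfMoeb_cfMat_mem (hw w) (Set.left_mem_Icc.2 zero_le_one)
    refine (F.norm_extend_sub_le hux hu0).trans ?_
    refine mul_le_mul_of_nonneg_left ?_ (norm_nonneg F)
    refine (abs_cfMoeb_sub_le_geom (hw w) x.2 (Set.left_mem_Icc.2 zero_le_one)).trans ?_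
    have : |(x : ℝ) - 0| ≤ 1 := by rw [sub_zero, abs_of_nonneg x.2.1]; exact x.2.2
    calc (1 / 2 : ℝ) ^ (N - 1) * |(x : ℝ) - 0| ≤ (1 / 2 : ℝ) ^ (N - 1) * 1 :=
          mul_le_mul_of_nonneg_left this (by positivity)
      _ = _ := mul_one _
  -- sup bound
  have hsup : ∀ x : Icc (0 : ℝ) 1, ‖cfSOp A hA hs N F x‖ ≤
      (4 : ℝ) ^ s.re * cfEig A s.re ^ N * ((1 / 2 : ℝ) ^ (N - 1) * ‖F‖) := by
    intro x
    rw [cfSOp_apply]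
    refine (norm_sum_le _ _).trans ?_
    calc ∑ w : Fin N → A, ‖cfWt s (cfMat fun i => (w i : ℕ)) x *
            (F.extend (cfMoeb (cfMat fun i => (w i : ℕ)) x) - F.extend (cfMoeb (cfMat fun i => (w i : ℕ)) 0))‖
        ≤ ∑ w : Fin N → A, ((cfDenom (cfMat fun i => (w i : ℕ)) x) ^ 2) ^ (-s.re) * (‖F‖ * (1 / 2 : ℝ) ^ (N - 1)) := by
          refine Finset.sum_le_sum fun w _ => ?_
          rw [norm_mul, norm_cfWt s _ (cfDenom_cfMat_pos (hw w) x.2)]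
          exact mul_le_mul_of_nonneg_left (hcontr w x) (Real.rpow_nonneg (sq_nonneg _) _)
      _ = cfTransferSum A s.re N (fun _ => 1) x * (‖F‖ * (1 / 2 : ℝ) ^ (N - 1)) := by
          rw [cfTransferSum, Finset.sum_mul]
          refine Finset.sum_congr rfl fun w _ => ?_
          rw [mul_one]
      _ ≤ (4 : ℝ) ^ s.re * cfEig A s.re ^ N * (‖F‖ * (1 / 2 : ℝ) ^ (N - 1)) :=
          mul_le_mul_of_nonneg_right (cfTransferSum_one_le' A hA hne hs N x.2) (by positivity)
      _ = _ := by ring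
  -- Lipschitz bound
  have hlip : ∀ x y : Icc (0 : ℝ) 1, ‖cfSOp A hA hs N F x - cfSOp A hA hs N F y‖ ≤
      (4 : ℝ) ^ s.re * cfEig A s.re ^ N * ((1 / 2 : ℝ) ^ (N - 1) * (1 + 2 * ‖s‖ * Real.exp (2 * ‖s‖)) * ‖F‖) *
        |(x : ℝ) - y| := by
    intro x y
    rw [cfSOp_apply, cfSOp_apply, ← Finset.sum_sub_distrib]
    refine (norm_sum_le _ _).trans ?_
    have hd1 : |(x : ℝ) - y| ≤ 1 := by
      rw [abs_le]; constructor <;> linarith [x.2.1, x.2.2, y.2.1, y.2.2]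
    have hterm : ∀ w : Fin N → A,
        ‖cfWt s (cfMat fun i => (w i : ℕ)) x *
              (F.extend (cfMoeb (cfMat fun i => (w i : ℕ)) x) - F.extend (cfMoeb (cfMat fun i => (w i : ℕ)) 0)) -
            cfWt s (cfMat fun i => (w i : ℕ)) y *
              (F.extend (cfMoeb (cfMat fun i => (w i : ℕ)) y) - F.extend (cfMoeb (cfMat fun i => (w i : ℕ)) 0))‖ ≤
          ((cfDenom (cfMat fun i => (w i : ℕ)) y) ^ 2) ^ (-s.re) *
            ((1 / 2 : ℝ) ^ (N - 1) * (1 + 2 * ‖s‖ * Real.exp (2 * ‖s‖)) * ‖F‖ * |(x : ℝ) - y|) := by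
      intro w
      set Mw := cfMat fun i => (w i : ℕ) with hMw
      have hdy := cfDenom_cfMat_pos (hw w) y.2
      have hux := cfMoeb_cfMat_mem (hw w) x.2
      have huy := cfMoeb_cfMat_mem (hw w) y.2
      have hpos : 0 ≤ ((cfDenom Mw y) ^ 2) ^ (-s.re) := Real.rpow_nonneg (sq_nonneg _) _
      have hsplit : cfWt s Mw x * (F.extend (cfMoeb Mw x) - F.extend (cfMoeb Mw 0)) -
          cfWt s Mw y * (F.extend (cfMoeb Mw y) - F.extend (cfMoeb Mw 0)) =
          (cfWt s Mw x - cfWt s Mw y) * (F.extend (cfMoeb Mw x) - F.extend (cfMoeb Mw 0)) +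
            cfWt s Mw y * (F.extend (cfMoeb Mw x) - F.extend (cfMoeb Mw y)) := by ring
      rw [hsplit]
      have h1 : ‖(cfWt s Mw x - cfWt s Mw y) * (F.extend (cfMoeb Mw x) - F.extend (cfMoeb Mw 0))‖ ≤
          ((cfDenom Mw y) ^ 2) ^ (-s.re) * (2 * ‖s‖ * Real.exp (2 * ‖s‖) * |(x : ℝ) - y|) *
            (‖F‖ * (1 / 2 : ℝ) ^ (N - 1)) := by
        rw [norm_mul]
        have hwd := norm_cfWt_sub_cfWt_le (hw w) s x.2 y.2
        have hexp : Real.exp (2 * ‖s‖ * |(x : ℝ) - y|) ≤ Real.exp (2 * ‖s‖) :=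
          Real.exp_le_exp.2 (by nlinarith [norm_nonneg s, abs_nonneg ((x : ℝ) - y)])
        refine mul_le_mul (hwd.trans ?_) (hcontr w x) (norm_nonneg _) (by positivity)
        refine mul_le_mul_of_nonneg_left ?_ hpos
        exact mul_le_mul_of_nonneg_right (mul_le_mul_of_nonneg_left hexp (by positivity)) (abs_nonneg _)
      have h2 : ‖cfWt s Mw y * (F.extend (cfMoeb Mw x) - F.extend (cfMoeb Mw y))‖ ≤
          ((cfDenom Mw y) ^ 2) ^ (-s.re) * (‖F‖ * ((1 / 2 : ℝ) ^ (N - 1) * |(x : ℝ) - y|)) := by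
        rw [norm_mul, norm_cfWt s _ hdy]
        refine mul_le_mul_of_nonneg_left ?_ hpos
        exact (F.norm_extend_sub_le hux huy).trans
          (mul_le_mul_of_nonneg_left (abs_cfMoeb_sub_le_geom (hw w) x.2 y.2) (norm_nonneg F))
      calc _ ≤ _ := norm_add_le _ _
        _ ≤ ((cfDenom Mw y) ^ 2) ^ (-s.re) * (2 * ‖s‖ * Real.exp (2 * ‖s‖) * |(x : ℝ) - y|) *
              (‖F‖ * (1 / 2 : ℝ) ^ (N - 1)) +
            ((cfDenom Mw y) ^ 2) ^ (-s.re) * (‖F‖ * ((1 / 2 : ℝ) ^ (N - 1) * |(x : ℝ) - y|)) := add_le_add h1 h2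
        _ = _ := by ring
    calc _ ≤ ∑ w : Fin N → A, ((cfDenom (cfMat fun i => (w i : ℕ)) y) ^ 2) ^ (-s.re) *
            ((1 / 2 : ℝ) ^ (N - 1) * (1 + 2 * ‖s‖ * Real.exp (2 * ‖s‖)) * ‖F‖ * |(x : ℝ) - y|) :=
          Finset.sum_le_sum fun w _ => hterm w
      _ = cfTransferSum A s.re N (fun _ => 1) y *
            ((1 / 2 : ℝ) ^ (N - 1) * (1 + 2 * ‖s‖ * Real.exp (2 * ‖s‖)) * ‖F‖ * |(x : ℝ) - y|) := by
          rw [cfTransferSum, Finset.sum_mul]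
          refine Finset.sum_congr rfl fun w _ => ?_
          rw [mul_one]
      _ ≤ (4 : ℝ) ^ s.re * cfEig A s.re ^ N *
            ((1 / 2 : ℝ) ^ (N - 1) * (1 + 2 * ‖s‖ * Real.exp (2 * ‖s‖)) * ‖F‖ * |(x : ℝ) - y|) :=
          mul_le_mul_of_nonneg_right (cfTransferSum_one_le' A hA hne hs N y.2) (by positivity)
      _ = _ := by ring
  calc ‖cfSOp A hA hs N F‖
      ≤ (4 : ℝ) ^ s.re * cfEig A s.re ^ N * ((1 / 2 : ℝ) ^ (N - 1) * ‖F‖) +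
          (4 : ℝ) ^ s.re * cfEig A s.re ^ N *
            ((1 / 2 : ℝ) ^ (N - 1) * (1 + 2 * ‖s‖ * Real.exp (2 * ‖s‖)) * ‖F‖) :=
        CfLip.norm_le_of_bounds (by positivity) hsup hlip
    _ = (4 : ℝ) ^ s.re * cfEig A s.re ^ N * (1 / 2 : ℝ) ^ (N - 1) * (2 + 2 * ‖s‖ * Real.exp (2 * ‖s‖)) * ‖F‖ := by
        ring

end Frozen

/-! ### No unimodular eigenvalues on the boundary line, and invertibility of `1 - L_s` -/

section Boundary

variable (A) (hA : ∀ a ∈ A, 1 ≤ a) (h2 : 2 ≤ A.card)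
include hA h2

omit hA in
/-- `A` has two distinct letters. [folklore] -/
theorem exists_ne_of_two_le_card : ∃ a ∈ A, ∃ b ∈ A, a ≠ b :=
  Finset.one_lt_card.1 h2

omit hA h2 in
/-- The real part of `δ + it` is `δ`. [folklore] -/
theorem re_delta_add (t : ℝ) : ((cfDimension A : ℂ) + t * Complex.I).re = cfDimension A := by
  simp

/-- **No unimodular eigenvalues on `Re s = δ`, `s ≠ δ`** (the non-lattice property on `CfLip`):
if `L_{δ+it} y = ω y` with `|ω| = 1`, `t ≠ 0`, `y ∈ CfLip`, then `y = 0`.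
[cite: MageeOhWinter2019, Lemma 15] -/
theorem cfLOp_eigen_eq_zero {t : ℝ} (ht : t ≠ 0) {ω : ℂ} (hω : ‖ω‖ = 1) {y : CfLip}
    (heig : cfLOp A hA ((cfDimension A : ℂ) + t * Complex.I) y = ω • y) : y = 0 := by
  have hcont : ContinuousOn y.extend (Icc 0 1) := (y.continuous.comp continuous_projIcc).continuousOn
  have hzero := cfLC_eigenfunction_eq_zero hA (exists_ne_of_two_le_card A h2) (cfDimension_pos hA h2).le
    ht hω hcont (fun x hx => by
      have h := congrArg (fun G : CfLip => G ⟨x, hx⟩) heig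
      simp only [cfLOp_apply, CfLip.smul_apply] at h
      rw [cfEig_cfDimension hA h2, Complex.ofReal_one, mul_one, CfLip.extend_of_mem _ hx]
      exact h)
  refine DFunLike.ext y 0 fun x => ?_
  have h := hzero x x.2
  rw [CfLip.extend_coe] at h
  exact h

/-- **No unimodular eigenvalues for rotated operators:** if `c L_{δ+it} v = ω v` with `|c| = |ω| = 1`,
`t ≠ 0`, then `v = 0`. [cite: MageeOhWinter2019, Lemma 15] -/
theorem smul_cfLOp_eigen_eq_zero {t : ℝ} (ht : t ≠ 0) {c ω : ℂ} (hc : ‖c‖ = 1) (hω : ‖ω‖ = 1) {y : CfLip}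
    (heig : (c • cfLOp A hA ((cfDimension A : ℂ) + t * Complex.I)) y = ω • y) : y = 0 := by
  have hc0 : c ≠ 0 := fun h => by rw [h, norm_zero] at hc; exact zero_ne_one hc
  refine cfLOp_eigen_eq_zero A hA h2 ht (ω := c⁻¹ * ω) (by rw [norm_mul, norm_inv, hc, hω]; norm_num) ?_
  have h : c • cfLOp A hA ((cfDimension A : ℂ) + t * Complex.I) y = ω • y := heig
  rw [mul_smul, ← h, smul_smul, inv_mul_cancel₀ hc0, one_smul]

/-- **No nonzero fixed vectors of `(c L_{δ+it})ᴺ`** (`|c| = 1`, `t ≠ 0`, `N ≥ 1`).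
[cite: MageeOhWinter2019, Lemma 15] -/
theorem smul_cfLOp_pow_fix_eq_zero {t : ℝ} (ht : t ≠ 0) {c : ℂ} (hc : ‖c‖ = 1) {N : ℕ} (hN : 0 < N) {x : CfLip}
    (hfix : ((c • cfLOp A hA ((cfDimension A : ℂ) + t * Complex.I)) ^ N) x = x) : x = 0 := by
  by_contra hx
  obtain ⟨ω, v, hω, hv, heig⟩ := exists_unimodular_eigenvector _ hN hx hfix
  exact hv (smul_cfLOp_eigen_eq_zero A hA h2 ht hc hω heig)

/-- **No nonzero fixed vectors of `L_{δ+it}ᴺ`** (`t ≠ 0`, `N ≥ 1`). [cite: MageeOhWinter2019, Lemma 15] -/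
theorem cfLOp_pow_fix_eq_zero {t : ℝ} (ht : t ≠ 0) {N : ℕ} (hN : 0 < N) {x : CfLip}
    (hfix : (cfLOp A hA ((cfDimension A : ℂ) + t * Complex.I) ^ N) x = x) : x = 0 :=
  smul_cfLOp_pow_fix_eq_zero A hA h2 ht (c := 1) norm_one hN (by rwa [one_smul])

/-- **Invertibility of `1 - c L_s` on the boundary line** for every unimodular `c`
([MageeOhWinter2019, Lemma 15]: "`N` is non-lattice and so `1 - L_s` is invertible" for
`Re s = δ`, `s ≠ δ`; the rotation `c` covers e.g. `1 + L_s`): for real `t ≠ 0` and `|c| = 1`,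
`1 - c L_{δ+it}` is a unit of the Banach algebra of bounded operators on the Lipschitz space.
[cite: MageeOhWinter2019, Lemma 15] -/
theorem isUnit_one_sub_smul_cfLOp_boundary {t : ℝ} (ht : t ≠ 0) {c : ℂ} (hc : ‖c‖ = 1) :
    IsUnit (1 - c • cfLOp A hA ((cfDimension A : ℂ) + t * Complex.I)) := by
  set s : ℂ := (cfDimension A : ℂ) + t * Complex.I with hsdef
  have hre : s.re = cfDimension A := re_delta_add A t
  have hs : 0 ≤ s.re := by rw [hre]; exact (cfDimension_pos hA h2).le
  have hne : A.Nonempty := nonempty_of_two_le_card h2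
  set T := c • cfLOp A hA s with hT
  -- choose `N` with `‖S_N‖ < 1`
  set C : ℝ := (4 : ℝ) ^ s.re * (2 + 2 * ‖s‖ * Real.exp (2 * ‖s‖)) with hC
  have hC0 : 0 < C := by positivity
  obtain ⟨m, hm⟩ := exists_pow_lt_of_lt_one (inv_pos.2 hC0) (by norm_num : (1 / 2 : ℝ) < 1)
  set N := m + 1 with hN
  have hcN : ‖c ^ N‖ = 1 := by rw [norm_pow, hc, one_pow]
  have hSlt : ‖c ^ N • cfSOp A hA hs N‖ < 1 := by
    rw [norm_smul, hcN, one_mul]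
    refine (norm_cfSOp_le A hA hne hs N).trans_lt ?_
    rw [hre, cfEig_cfDimension hA h2, one_pow, mul_one, ← hre, show N - 1 = m from rfl]
    calc (4 : ℝ) ^ s.re * (1 / 2 : ℝ) ^ m * (2 + 2 * ‖s‖ * Real.exp (2 * ‖s‖)) = C * (1 / 2 : ℝ) ^ m := by ring
      _ < C * C⁻¹ := mul_lt_mul_of_pos_left hm hC0
      _ = 1 := mul_inv_cancel₀ hC0.ne'
  -- the factorization `1 - Tᴺ = (1 - S)(1 - R K)` with `R = (1 - S)⁻¹`
  set S := c ^ N • cfSOp A hA hs N with hS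
  set K := c ^ N • cfKOp A hA hs N with hK
  have hTN : T ^ N = S + K := by
    rw [hT, smul_pow, hS, hK, ← smul_add, cfSOp, sub_add_cancel]
  obtain ⟨u, hu⟩ := isUnit_one_sub_of_norm_lt_one hSlt
  set R : CfLip →L[ℂ] CfLip := ↑u⁻¹ with hR
  have hRl : (1 - S) * R = 1 := by rw [← hu, hR, Units.mul_inv]
  have hRr : R * (1 - S) = 1 := by rw [← hu, hR, Units.inv_mul]
  have hfac : 1 - T ^ N = (1 - S) * (1 - R * K) := by
    rw [mul_sub, mul_one, ← mul_assoc, hRl, one_mul, hTN]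
    abel
  -- `1 - R K` is a unit by the Fredholm alternative
  have hfin : FiniteDimensional ℂ (LinearMap.range ((R * K : CfLip →L[ℂ] CfLip) : CfLip →ₗ[ℂ] CfLip)) := by
    haveI := cfKOp_finiteDimensional A hA hs N
    have hle : LinearMap.range ((R * K : CfLip →L[ℂ] CfLip) : CfLip →ₗ[ℂ] CfLip) ≤
        (LinearMap.range (cfKOp A hA hs N : CfLip →ₗ[ℂ] CfLip)).map (R : CfLip →ₗ[ℂ] CfLip) := by
      rintro _ ⟨F, rfl⟩
      refine ⟨cfKOp A hA hs N (c ^ N • F), LinearMap.mem_range_self _ _, ?_⟩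
      show R (cfKOp A hA hs N (c ^ N • F)) = R (K F)
      rw [hK, map_smul]
      rfl
    exact Submodule.finiteDimensional_of_le hle
  have hinj : ∀ x, (R * K) x = x → x = 0 := by
    intro x hx
    apply smul_cfLOp_pow_fix_eq_zero A hA h2 ht hc (Nat.succ_pos m) (N := N)
    have h1 : (1 - R * K) x = 0 := by
      show x - (R * K) x = 0
      rw [hx, sub_self]
    have h2' : (1 - T ^ N) x = 0 := by rw [hfac, ContinuousLinearMap.mul_def, ContinuousLinearMap.coe_comp,
      Function.comp_apply, h1, map_zero]
    have h3 : x - (T ^ N) x = 0 := h2'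
    exact (sub_eq_zero.1 h3).symm
  have hunitK := isUnit_one_sub_of_finiteDimensional_range (R * K) hfin hinj
  have hunitN : IsUnit (1 - T ^ N) := by
    rw [hfac, ← hu]
    exact (Units.isUnit u).mul hunitK
  -- from `1 - Tᴺ` to `1 - T`
  have hgeom : (1 - T) * ∑ i ∈ range N, T ^ i = 1 - T ^ N := mul_neg_geom_sum T N
  have hcomm : Commute (1 - T) (∑ i ∈ range N, T ^ i) :=
    (Commute.sum_right _ _ _ fun i _ => (Commute.one_left T).sub_left (Commute.refl T) |>.pow_right i)
  rw [← hgeom] at hunitN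
  exact ((hcomm.isUnit_mul_iff).1 hunitN).1

/-- **Invertibility of `1 - L_s` on the boundary line** ([MageeOhWinter2019, Lemma 15]): for every
real `t ≠ 0`, `1 - L_{δ+it}` is a unit. [cite: MageeOhWinter2019, Lemma 15] -/
theorem isUnit_one_sub_cfLOp_boundary {t : ℝ} (ht : t ≠ 0) :
    IsUnit (1 - cfLOp A hA ((cfDimension A : ℂ) + t * Complex.I)) := by
  have h := isUnit_one_sub_smul_cfLOp_boundary A hA h2 ht (c := 1) norm_one
  rwa [one_smul] at h

/-- **Invertibility of `1 + L_s` on the boundary line minus `δ`:** for real `t ≠ 0`, `1 + L_{δ+it}` is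
a unit (no eigenvalue `-1`). [cite: MageeOhWinter2019, Lemma 15] -/
theorem isUnit_one_add_cfLOp_boundary {t : ℝ} (ht : t ≠ 0) :
    IsUnit (1 + cfLOp A hA ((cfDimension A : ℂ) + t * Complex.I)) := by
  have h := isUnit_one_sub_smul_cfLOp_boundary A hA h2 ht (c := -1) (by simp)
  rwa [neg_one_smul, sub_neg_eq_add] at h

end Boundary

end Literature.NumberTheory.Sieve
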